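import Mathlib.Algebra.Polynomial.Derivative
import Mathlib.Algebra.Polynomial.Eval.Degree
import Mathlib.Algebra.MvPolynomial.PDeriv
import Mathlib.LinearAlgebra.Vandermonde
import Mathlib.LinearAlgebra.Matrix.NonsingularInverse
import Literature.Computability.AlgebraicComplexity.IMMInVPProofs
import HarnessLib

/-!
# Guo–Kumar–Saptharishi–Solomon 2019, §3: "by interpolation, the size of `∂_{x_n^i}(C)` is at most
# `O(s·D)`" — the circuit cost of iterated partial derivatives in one variable

Cell `val-lit`, seat t19 (literature-prover); groundwork for the discharge programme of
`GKSS2019_mainThm` (v2, erratum A34) along the printed proof of [GKSS19, §3]. THEOREM-ONLY (no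
definitions, no named facts); nothing here bears on `VP ≠ VNP`, which is NOT proved.

Source: Z. Guo, M. Kumar, R. Saptharishi, N. Solomon, *Derandomization from algebraic hardness*,
SIAM J. Comput. 51 (2022) = arXiv:1905.00091 [GuoKumarSaptharishiSolomon2019], §3, the sentence
after Claim 23 (held text `paper:arxiv-1905.00091`, p0011.txt:L42–L43): "Let `C' = ∂_{x_n^i}(C)`.
… By interpolation, its size `s' ≤ s · D` (where, recall, `D ≥ deg(C)`)", and §1.3
(p0007.txt:L4–L6: "Standard interpolation arguments shows that the circuit complexity of `C'` is
at most `O(sD)`").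

## What is here (the interpolation argument, written out)

For `f ∈ k[x]` (`k` a field) and a variable `x_m` of individual degree `≤ D` in `f`:
* `aeval_taylorVar_pderiv`, `aeval_taylorVar_pderiv_iterate` — `f(…, x_m + T, …) ∈ k[x][T]`
  intertwines `∂_{x_m}` with `d/dT`;
* `eval_aeval_taylorVar` — `T := t` gives `f(…, x_m + t, …)`; `iterate_pderiv_eq_factorial_mul_coeff`
  — `∂_{x_m^a} f = a! · coeff_{T^a} f(…, x_m + T, …)`;
* `natDegree_aeval_taylorVar_le` — the `T`-degree is `≤ deg_{x_m} f`;
* `coeff_eq_sum_vandermonde_inv` — interpolation on `T` over the coefficient ring: for a polynomial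
  of degree `≤ D` and `D+1` distinct scalars `c_u`, `coeff_a = ∑_u (V⁻¹)_{a,u} · eval (c_u)`
  (`V` the Vandermonde matrix);
* **`complexity_iterate_pderiv_le`** — in characteristic `0`, with `c_u = 0, 1, …, D`:
  `L(∂_{x_m^a} f) ≤ (D+1) · (L(f) + 2) + (D+1) + 1` for `a ≤ D` and `deg_{x_m} f ≤ D`
  (`D+1` shifted copies `f(…, x_m + c_u, …)`, each of cost `≤ L(f) + 1`, combined linearly).

## References
* [GuoKumarSaptharishiSolomon2019] arXiv:1905.00091, §3 (p0011.txt:L42–43), §1.3 (p0007.txt:L4–6).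
* [Burgisser2000] Rem. 2.7 (substitution bound, tree `complexity_aeval_le`).
-/

noncomputable section

open MvPolynomial

namespace Literature.Computability.AlgebraicComplexity

namespace GKSS2019

universe u v

variable {k : Type u} [Field k] {τ : Type v} [DecidableEq τ]

/-! ### `f(…, x_m + T, …) ∈ k[x][T]` -/

/-- `∂_{x_m}` becomes `d/dT` on `f(…, x_m + T, …)`. [cite: GuoKumarSaptharishiSolomon2019, §3 (arXiv p0011.txt:L42-43), "by interpolation"] -/
theorem aeval_taylorVar_pderiv (m : τ) (f : MvPolynomial τ k) :
    aeval (fun i => Polynomial.C (X i) +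
        if i = m then (Polynomial.X : Polynomial (MvPolynomial τ k)) else 0) (pderiv m f) =
      Polynomial.derivative (aeval (fun i => Polynomial.C (X i) +
        if i = m then (Polynomial.X : Polynomial (MvPolynomial τ k)) else 0) f) := by
  induction f using MvPolynomial.induction_on with
  | C c =>
    rw [pderiv_C, map_zero, MvPolynomial.algHom_C, Polynomial.algebraMap_apply,
      Polynomial.derivative_C]
  | add p q hp hq => simp only [map_add, hp, hq]
  | mul_X p i hp =>
    rw [pderiv_mul, map_add, map_mul, map_mul, hp, map_mul, aeval_X, Polynomial.derivative_mul]
    by_cases him : i = m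
    · subst him
      simp
    · rw [pderiv_X_of_ne him, map_zero, mul_zero, add_zero, if_neg him, add_zero,
        Polynomial.derivative_C, mul_zero, add_zero]

/-- Iterated form. [cite: GuoKumarSaptharishiSolomon2019, §3 (arXiv p0011.txt:L42-43)] -/
theorem aeval_taylorVar_pderiv_iterate (m : τ) (f : MvPolynomial τ k) (a : ℕ) :
    aeval (fun i => Polynomial.C (X i) +
        if i = m then (Polynomial.X : Polynomial (MvPolynomial τ k)) else 0) ((pderiv m)^[a] f) =
      Polynomial.derivative^[a] (aeval (fun i => Polynomial.C (X i) +
        if i = m then (Polynomial.X : Polynomial (MvPolynomial τ k)) else 0) f) := by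
  induction a with
  | zero => rfl
  | succ a ih =>
    rw [Function.iterate_succ_apply', Function.iterate_succ_apply', aeval_taylorVar_pderiv, ih]

/-- `T := t` gives the shifted copy `f(…, x_m + t, …)`. [cite: GuoKumarSaptharishiSolomon2019, §3 (arXiv p0011.txt:L42-43)] -/
theorem eval_aeval_taylorVar (m : τ) (f : MvPolynomial τ k) (t : MvPolynomial τ k) :
    Polynomial.eval t (aeval (fun i => Polynomial.C (X i) +
        if i = m then (Polynomial.X : Polynomial (MvPolynomial τ k)) else 0) f) =
      aeval (fun i => if i = m then X i + t else X i) f := by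
  induction f using MvPolynomial.induction_on with
  | C c =>
    rw [MvPolynomial.algHom_C, MvPolynomial.algHom_C, Polynomial.algebraMap_apply, Polynomial.eval_C,
      MvPolynomial.algebraMap_eq]
  | add p q hp hq => rw [map_add, map_add, Polynomial.eval_add, hp, hq]
  | mul_X p i hp =>
    rw [map_mul, map_mul, Polynomial.eval_mul, hp, aeval_X, aeval_X]
    by_cases him : i = m
    · subst him; simp
    · simp [if_neg him]

/-- **`∂_{x_m^a} f = a! · coeff_{T^a} f(…, x_m + T, …)`** (Taylor's formula in one variable, any
characteristic, no division). [cite: GuoKumarSaptharishiSolomon2019, §3 (arXiv p0011.txt:L42-43)] -/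
theorem iterate_pderiv_eq_factorial_mul_coeff (m : τ) (f : MvPolynomial τ k) (a : ℕ) :
    (pderiv m)^[a] f = (a.factorial : MvPolynomial τ k) *
      (aeval (fun i => Polynomial.C (X i) +
        if i = m then (Polynomial.X : Polynomial (MvPolynomial τ k)) else 0) f).coeff a := by
  have h0 : (pderiv m)^[a] f = Polynomial.eval 0 (aeval (fun i => Polynomial.C (X i) +
      if i = m then (Polynomial.X : Polynomial (MvPolynomial τ k)) else 0) ((pderiv m)^[a] f)) := by
    rw [eval_aeval_taylorVar]
    have : (fun i => if i = m then X i + (0 : MvPolynomial τ k) else X i) = X := by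
      funext i; split_ifs <;> simp
    rw [this, aeval_X_left_apply]
  rw [h0, aeval_taylorVar_pderiv_iterate, ← Polynomial.coeff_zero_eq_eval_zero,
    Polynomial.coeff_iterate_derivative, zero_add, Nat.descFactorial_self, nsmul_eq_mul]

/-- The `T`-degree of `f(…, x_m + T, …)` is at most `deg_{x_m} f`. [cite: GuoKumarSaptharishiSolomon2019, §3 (arXiv p0011.txt:L42-43), "`D ≥ deg(C)`"] -/
theorem natDegree_aeval_taylorVar_le (m : τ) (f : MvPolynomial τ k) :
    (aeval (fun i => Polynomial.C (X i) +
        if i = m then (Polynomial.X : Polynomial (MvPolynomial τ k)) else 0) f).natDegree ≤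
      degreeOf m f := by
  classical
  set φ : τ → Polynomial (MvPolynomial τ k) := fun i => Polynomial.C (X i) +
      if i = m then (Polynomial.X : Polynomial (MvPolynomial τ k)) else 0 with hφ
  have hφdeg : ∀ i, (φ i).natDegree ≤ if i = m then 1 else 0 := by
    intro i
    by_cases him : i = m
    · subst him
      simp only [hφ, if_true]
      refine (Polynomial.natDegree_add_le _ _).trans ?_
      simp
    · simp [hφ, if_neg him]
  conv_lhs => rw [f.as_sum, map_sum]
  refine Polynomial.natDegree_sum_le_of_forall_le _ _ fun e he => ?_
  rw [aeval_monomial]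
  have hC : (algebraMap k (Polynomial (MvPolynomial τ k)) (coeff e f)) =
      Polynomial.C (C (coeff e f)) := by
    rw [IsScalarTower.algebraMap_apply k (MvPolynomial τ k) (Polynomial (MvPolynomial τ k)),
      MvPolynomial.algebraMap_eq, Polynomial.algebraMap_eq]
  rw [hC]
  refine (Polynomial.natDegree_C_mul_le _ _).trans ?_
  rw [Finsupp.prod]
  refine (Polynomial.natDegree_prod_le _ _).trans ?_
  calc ∑ i ∈ e.support, (φ i ^ e i).natDegree
      ≤ ∑ i ∈ e.support, e i * (if i = m then 1 else 0) :=
        Finset.sum_le_sum fun i _ => (Polynomial.natDegree_pow_le).trans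
          (Nat.mul_le_mul_left _ (hφdeg i))
    _ = ∑ i ∈ e.support, (if i = m then e i else 0) :=
        Finset.sum_congr rfl fun i _ => by split_ifs <;> simp
    _ ≤ e m := by
        rw [Finset.sum_ite_eq' e.support m (fun i => e i)]
        split_ifs <;> simp
    _ ≤ degreeOf m f := by
        rw [degreeOf_eq_sup]
        exact Finset.le_sup (f := fun d : τ →₀ ℕ => d m) he

/-! ### Interpolation on the kept variable -/

/-- **Interpolation over the coefficient ring.** For a polynomial `p ∈ R[T]` over a commutative
`k`-algebra `R` with `deg p ≤ D`, and `D+1` distinct scalars `c_0, …, c_D ∈ k`, each coefficient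
is a fixed `k`-linear combination of the values `p(c_u)`: `coeff_a p = ∑_u (V⁻¹)_{a,u} · p(c_u)`,
`V_{u,a} = c_u^a` the Vandermonde matrix. [cite: GuoKumarSaptharishiSolomon2019, §3 (arXiv p0011.txt:L42-43), "by interpolation"] -/
theorem coeff_eq_sum_vandermonde_inv {R : Type*} [CommRing R] [Algebra k R] {D : ℕ}
    (c : Fin (D + 1) → k) (hc : Function.Injective c) (p : Polynomial R) (hp : p.natDegree ≤ D)
    (a : Fin (D + 1)) :
    p.coeff a = ∑ u : Fin (D + 1), algebraMap k R ((Matrix.vandermonde c)⁻¹ a u) *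
      p.eval (algebraMap k R (c u)) := by
  set V : Matrix (Fin (D + 1)) (Fin (D + 1)) k := Matrix.vandermonde c with hV
  have hdet : IsUnit V.det :=
    isUnit_iff_ne_zero.mpr (Matrix.det_vandermonde_ne_zero_iff.mpr hc)
  set cv : Fin (D + 1) → R := fun j => p.coeff j with hcv
  set ev : Fin (D + 1) → R := fun u => p.eval (algebraMap k R (c u)) with hev
  -- the values are `V.map (algebraMap k R)` applied to the coefficients
  have hval : ev = Matrix.mulVec (V.map (algebraMap k R)) cv := by
    funext u
    rw [hev, Matrix.mulVec, dotProduct]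
    simp only [Matrix.map_apply, hV, Matrix.vandermonde_apply, map_pow, hcv]
    rw [Polynomial.eval_eq_sum_range' (Nat.lt_succ_of_le hp), Finset.sum_range]
    exact Finset.sum_congr rfl fun j _ => mul_comm _ _
  -- invert
  have hinv : Matrix.mulVec (V⁻¹.map (algebraMap k R)) ev = cv := by
    rw [hval, Matrix.mulVec_mulVec, ← Matrix.map_mul, Matrix.nonsing_inv_mul _ hdet,
      Matrix.map_one _ (map_zero _) (map_one _), Matrix.one_mulVec]
  have := congrFun hinv a
  rw [Matrix.mulVec, dotProduct] at this
  have hcva : p.coeff a = cv a := rfl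
  rw [hcva, ← this]
  simp only [Matrix.map_apply, hev]

/-! ### The cost bound -/

variable [Fintype τ]

/-- A shifted copy `f(…, x_m + t, …)` by a constant costs one extra gate.
[cite: Burgisser2000, Rem. 2.7] -/
theorem complexity_shift_le (m : τ) (f : MvPolynomial τ k) (t : k) :
    complexity (aeval (fun i => if i = m then X i + C t else X i) f) ≤ complexity f + 1 := by
  classical
  refine (complexity_aeval_le f _).trans (Nat.add_le_add_left ?_ _)
  have h : ∀ i, complexity ((if i = m then X i + C t else X i : MvPolynomial τ k)) ≤
      if i = m then 1 else 0 := by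
    intro i
    by_cases him : i = m
    · subst him
      simp only [if_true]
      calc complexity (X i + C t : MvPolynomial τ k)
          ≤ complexity (X i : MvPolynomial τ k) + complexity (C t : MvPolynomial τ k) + 1 :=
            complexity_add_le_holds _ _
        _ = 1 := by rw [complexity_X_holds, complexity_C_holds]
    · rw [if_neg him, if_neg him, Nat.le_zero]
      exact complexity_X_holds i
  calc ∑ i, complexity ((if i = m then X i + C t else X i : MvPolynomial τ k))
      ≤ ∑ i : τ, (if i = m then 1 else 0) := Finset.sum_le_sum fun i _ => h i
    _ = 1 := by simp

/-- **"By interpolation, its size `s' ≤ s·D`"** (GKSS §3, after Claim 23; §1.3 "the circuit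
complexity of `C'` is at most `O(sD)`"), in the tree's fan-in-two measure and characteristic `0`:
for `deg_{x_m} f ≤ D` and `a ≤ D`,
`L(∂_{x_m^a} f) ≤ (D+1)·(L(f) + 2) + (D+1) + 1` — `D+1` shifted copies `f(…, x_m + u, …)`,
`u = 0, …, D`, combined with the constants `a! · (V⁻¹)_{a,u}`.
[cite: GuoKumarSaptharishiSolomon2019, §3 (arXiv p0011.txt:L42-43) and §1.3 (p0007.txt:L4-6)] -/
theorem complexity_iterate_pderiv_le [CharZero k] (m : τ) (f : MvPolynomial τ k) {D a : ℕ}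
    (hdeg : degreeOf m f ≤ D) (ha : a ≤ D) :
    complexity ((pderiv m)^[a] f) ≤ (D + 1) * (complexity f + 2) + (D + 1) + 1 := by
  classical
  -- the interpolation nodes `0, 1, …, D`
  set c : Fin (D + 1) → k := fun u => (u : ℕ) with hc
  have hcinj : Function.Injective c := fun u v huv => by
    have : ((u : ℕ) : k) = ((v : ℕ) : k) := huv
    exact Fin.ext (Nat.cast_injective this)
  set g := aeval (fun i => Polynomial.C (X i) +
      if i = m then (Polynomial.X : Polynomial (MvPolynomial τ k)) else 0) f with hg
  have hgdeg : g.natDegree ≤ D := (natDegree_aeval_taylorVar_le m f).trans hdeg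
  have hcoeff := coeff_eq_sum_vandermonde_inv (R := MvPolynomial τ k) c hcinj g hgdeg ⟨a, by omega⟩
  simp only [MvPolynomial.algebraMap_eq] at hcoeff
  have hshift : ∀ u : Fin (D + 1), g.eval (C (c u)) =
      aeval (fun i => if i = m then X i + C (c u) else X i) f := fun u => by
    rw [hg, eval_aeval_taylorVar]
  -- `∂^a f = a! · ∑_u β_{a,u} · f(x_m + c_u)`
  have hrepr : (pderiv m)^[a] f = C (a.factorial : k) *
      ∑ u : Fin (D + 1), C ((Matrix.vandermonde c)⁻¹ ⟨a, by omega⟩ u) *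
        aeval (fun i => if i = m then X i + C (c u) else X i) f := by
    rw [iterate_pderiv_eq_factorial_mul_coeff, ← hg, map_natCast]
    congr 1
    calc g.coeff a = g.coeff ((⟨a, by omega⟩ : Fin (D + 1)) : ℕ) := rfl
      _ = _ := hcoeff
      _ = _ := Finset.sum_congr rfl fun u _ => by rw [hshift]
  rw [hrepr]
  calc complexity (C (a.factorial : k) * ∑ u : Fin (D + 1),
        C ((Matrix.vandermonde c)⁻¹ ⟨a, by omega⟩ u) *
          aeval (fun i => if i = m then X i + C (c u) else X i) f)
      ≤ complexity (C (a.factorial : k) : MvPolynomial τ k) + complexity (∑ u : Fin (D + 1),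
          C ((Matrix.vandermonde c)⁻¹ ⟨a, by omega⟩ u) *
            aeval (fun i => if i = m then X i + C (c u) else X i) f) + 1 :=
        complexity_mul_le_holds _ _
    _ ≤ 0 + (∑ u : Fin (D + 1), (complexity f + 2) + (Finset.univ : Finset (Fin (D + 1))).card)
          + 1 := by
        rw [complexity_C_holds]
        refine Nat.add_le_add_right (Nat.add_le_add_left ((complexity_finset_sum_le _ _).trans
          (Nat.add_le_add_right (Finset.sum_le_sum fun u _ => ?_) _)) _) _
        calc complexity (C ((Matrix.vandermonde c)⁻¹ ⟨a, by omega⟩ u) *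
              aeval (fun i => if i = m then X i + C (c u) else X i) f)
            ≤ complexity (C ((Matrix.vandermonde c)⁻¹ ⟨a, by omega⟩ u) : MvPolynomial τ k) +
                complexity (aeval (fun i => if i = m then X i + C (c u) else X i) f) + 1 :=
              complexity_mul_le_holds _ _
          _ ≤ 0 + (complexity f + 1) + 1 := by
              rw [complexity_C_holds]
              exact Nat.add_le_add_right (Nat.add_le_add_left (complexity_shift_le m f _) _) _
          _ = complexity f + 2 := by ring
    _ = (D + 1) * (complexity f + 2) + (D + 1) + 1 := by
        simp [Finset.sum_const, Finset.card_univ, Fintype.card_fin]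

end GKSS2019

end Literature.Computability.AlgebraicComplexity
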